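import Literature.Topology.FourManifolds.SeifertBandHomeomorph
import Literature.Topology.FourManifolds.CircleBandCut
import HarnessLib

/-!
# The circle-valued map of a knot complement pinched along the band of its Seifert surface

Topic `Literature/Topology/FourManifolds`; third step of the bicollar of a Seifert surface
(after `SeifertSheetLevelFn.lean`, `SeifertBandHomeomorph.lean`): the input `CircleBandData` of
the Seifert presentation of the Alexander module (`CircleBandCut.lean`,
`KnotAlexanderPresentation.lean`, `SliceKnotsFoxMilnorPairing.lean`). For a Seifert datum `D` of
the knot `K` and a unit-speed field `U` across `Λ` (flow `fl`, drop `drop`, band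
`N = D.band U ≃ₜ F° × (-1, 1)` about the open Seifert surface `F° = D.surf`, of normalised height
`h = f / (w ∘ drop) ∈ (-1, 1)`):

* `SeifertDatum.circleMap D U : C(S³ ∖ K, S¹)` — **the circle-valued map** `e^{iπ h}` on the band,
  `-1` off it (Rolfsen 1976, §5.C: the map to the circle collapsing the complement of a bicollar
  of the Seifert surface). Its continuity across the frontier of the band
  (`continuousAt_circleMapFn`) is the compactness lemma of `SeifertBandHomeomorph.lean`: off the
  compact flow-out `Q_ε` of `closure F° × [-(1-ε), 1-ε]`, which meets the knot complement inside
  the band, the normalised height of band points exceeds `1 - ε` in modulus;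
* `circleMap_eq_one_iff` — **`{circleMap = 1} = F°`**, `circleMap_ne_neg_one_iff` —
  **`{circleMap ≠ -1} = N`**, and `sheetLevel_circleMap` — on the band the branch of the angle
  in `(-π, π)` is `π h`;
* `SeifertDatum.circleBandData D U : CircleBandData (D.circleMap U)` — **the band trivialised
  over the angle**, `Ψ (y, t) = fl y (t · w y)` with `sheetLevel (Ψ (y, t)) = π t`;
* `pathConnectedSpace_circleMap_level` — the cut `{circleMap = 1} ≅ F°` is path connected.

What remains for the presentation of the Alexander module of `K` along this cut is the winding
number of the meridian (next file) and a basis of `H₁(F°; ℤ)`.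
Everything is proved; no named fact is introduced.

## References

* D. Rolfsen, *Knots and Links*, Publish or Perish (1976), §5.A, §5.C (bicollared Seifert
  surfaces and the map to the circle), §8.C. [Rolfsen1976]
* J. Milnor, *Morse theory*, Ann. of Math. Studies 51 (1963), Thm. 3.1. [Milnor1963]
-/

open scoped Manifold ContDiff Topology Real
open Function Set Filter Metric
open Literature.Topology.FourManifolds.CircleMaps.CyclicCover

noncomputable section

namespace Literature.Topology.FourManifolds

/-- Local notation: `𝔼 n` is the model Euclidean space `EuclideanSpace ℝ (Fin n)`. -/
local notation "𝔼 " n:arg => EuclideanSpace ℝ (Fin n)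

/-- Local notation: `𝕊 n` is the unit sphere in `EuclideanSpace ℝ (Fin (n + 1))`. -/
local notation "𝕊 " n:arg => (Metric.sphere (0 : EuclideanSpace ℝ (Fin (n + 1))) 1)

namespace SeifertDatum

open scoped Classical

variable {K : Knot} (D : SeifertDatum K) (U : LevelUnitField 2 D.sphereLevelFn 0)

/-! ### The normalised height and the circle map on the sphere -/

/-- **The normalised height** `h = f / (w ∘ drop)` (meaningful on the band, where it lies in
`(-1, 1)`). [folklore] -/
def height (q : 𝕊 3) : ℝ := D.sphereLevelFn q / D.width U (U.drop q)

/-- The height is continuous on the band. [folklore] -/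
theorem continuousOn_height : ContinuousOn (D.height U) (D.band U) := by
  refine (D.continuous_sphereLevelFn.continuousOn).div
    (((D.continuous_width U).comp U.continuous_drop).continuousOn) fun q hq => ?_
  exact (D.width_pos U (D.surf_subset_compl_range hq.2.1)).ne'

/-- On the band `|h| < 1`. [folklore] -/
theorem abs_height_lt_one {q : 𝕊 3} (hq : q ∈ D.band U) : |D.height U q| < 1 :=
  D.abs_div_width_lt_one U hq

/-- **The height of `Ψ̂ (y, t)` is `t`.** [folklore] -/
theorem height_bandMap {y : 𝕊 3} (hy : y ∈ D.surf) {t : ℝ} (ht : |t| ≤ 1) :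
    D.height U (D.bandMap U y t) = t := by
  have hy0 := D.sphereLevelFn_eq_zero_of_mem_surf hy
  have hw : 0 < D.width U y := D.width_pos U (D.surf_subset_compl_range hy)
  rw [height, D.drop_bandMap U hy0 ht, D.sphereLevelFn_bandMap U hy0 ht, mul_div_cancel_right₀ _ hw.ne']

/-- On `F°` the height vanishes. [folklore] -/
theorem height_eq_zero_of_mem_surf {y : 𝕊 3} (hy : y ∈ D.surf) : D.height U y = 0 := by
  rw [height, D.sphereLevelFn_eq_zero_of_mem_surf hy, zero_div]

/-- `F°` lies in the band. [folklore] -/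
theorem surf_subset_band : D.surf ⊆ D.band U := fun y hy => by
  have h := D.bandMap_mem_band U hy (t := 0) (by norm_num)
  rwa [bandMap, zero_mul, U.fl_zero] at h

/-- A band point of height `0` lies on `F°`. [folklore] -/
theorem mem_surf_of_height_eq_zero {q : 𝕊 3} (hq : q ∈ D.band U) (h0 : D.height U q = 0) : q ∈ D.surf := by
  have hw : 0 < D.width U (U.drop q) := D.width_pos U (D.surf_subset_compl_range hq.2.1)
  have hf : D.sphereLevelFn q = 0 := by
    rw [height, div_eq_zero_iff, or_iff_left hw.ne'] at h0; exact h0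
  have hd : U.drop q = q := U.drop_of_apply_eq hf
  rw [← hd]; exact hq.2.1

/-- **The circle map on the sphere**: `e^{iπ h}` on the band, `-1 = e^{-iπ}` off it. [cite: Rolfsen1976, §5.C] -/
def circleMapFn (q : 𝕊 3) : Circle :=
  if q ∈ D.band U then Circle.exp (π * D.height U q) else Circle.exp (-π)

/-- On the band. [folklore] -/
theorem circleMapFn_of_mem {q : 𝕊 3} (hq : q ∈ D.band U) :
    D.circleMapFn U q = Circle.exp (π * D.height U q) := if_pos hq

/-- Off the band. [folklore] -/
theorem circleMapFn_of_not_mem {q : 𝕊 3} (hq : q ∉ D.band U) :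
    D.circleMapFn U q = Circle.exp (-π) := if_neg hq

/-- `e^{iπ} = e^{-iπ}`. [folklore] -/
theorem exp_pi_eq_exp_neg_pi : Circle.exp π = Circle.exp (-π) := by
  rw [← Circle.exp_add_two_pi (-π)]
  congr 1
  ring

/-- **Neighbourhoods of `-1` contain `e^{iπ s}` for `|s|` close to `1`.** [folklore] -/
theorem exists_pos_forall_exp_mem {W : Set Circle} (hW : W ∈ 𝓝 (Circle.exp (-π))) :
    ∃ ε > 0, ∀ s : ℝ, 1 - ε ≤ |s| → |s| ≤ 1 → Circle.exp (π * s) ∈ W := by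
  have hg : Continuous fun s : ℝ => Circle.exp (π * s) := Circle.exp.continuous.comp (continuous_const.mul continuous_id)
  have h1 : ∀ᶠ s in 𝓝 (-1 : ℝ), Circle.exp (π * s) ∈ W := by
    apply hg.continuousAt.preimage_mem_nhds
    rwa [mul_neg, mul_one]
  have h2 : ∀ᶠ s in 𝓝 (1 : ℝ), Circle.exp (π * s) ∈ W := by
    apply hg.continuousAt.preimage_mem_nhds
    rwa [mul_one, exp_pi_eq_exp_neg_pi]
  obtain ⟨ε₁, hε₁, h1'⟩ := Metric.eventually_nhds_iff.1 h1
  obtain ⟨ε₂, hε₂, h2'⟩ := Metric.eventually_nhds_iff.1 h2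
  refine ⟨min ε₁ ε₂ / 2, by positivity, fun s hs hs1 => ?_⟩
  rcases le_or_gt 0 s with h | h
  · rw [abs_of_nonneg h] at hs hs1
    apply h2'
    rw [Real.dist_eq, abs_sub_comm, abs_of_nonneg (by linarith)]
    linarith [min_le_right ε₁ ε₂]
  · rw [abs_of_neg h] at hs hs1
    apply h1'
    rw [Real.dist_eq, show s - -1 = s + 1 by ring, abs_of_nonneg (by linarith)]
    linarith [min_le_left ε₁ ε₂]

/-- **The circle map is continuous at every point off the knot.** On the band it is
`e^{iπ h}` with `h` continuous; at a point `q` off the band and off the knot, for a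
neighbourhood `W ∋ -1` and the `ε` of `exists_pos_forall_exp_mem`, the complement of the
compact `Q_ε` and of `K` is a neighbourhood of `q` on which band points have `|h| > 1 - ε`
(`abs_le_of_mem_image_bandMap`, `mem_image_bandMap_of_abs_le`), so the map lands in `W`.
[cite: Rolfsen1976, §5.C] -/
theorem continuousAt_circleMapFn {q : 𝕊 3} (hK : q ∉ range ⇑K) : ContinuousAt (D.circleMapFn U) q := by
  by_cases hq : q ∈ D.band U
  · have hev : D.circleMapFn U =ᶠ[𝓝 q] fun p => Circle.exp (π * D.height U p) := by
      filter_upwards [(D.isOpen_band U).mem_nhds hq] with p hp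
      exact D.circleMapFn_of_mem U hp
    refine ContinuousAt.congr ?_ hev.symm
    exact Circle.exp.continuous.continuousAt.comp
      (continuousAt_const.mul ((D.continuousOn_height U).continuousAt ((D.isOpen_band U).mem_nhds hq)))
  · rw [ContinuousAt, D.circleMapFn_of_not_mem U hq]
    intro W hW
    obtain ⟨ε, hε, hεW⟩ := exists_pos_forall_exp_mem hW
    set Q : Set (𝕊 3) := (fun p : (𝕊 3) × ℝ => D.bandMap U p.1 p.2) ''
      (closure D.surf ×ˢ Icc (-(1 - ε)) (1 - ε)) with hQ
    have hQc : IsClosed Q := (D.isCompact_image_bandMap U ε).isClosed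
    have hqQ : q ∉ Q := fun h => hq (D.abs_le_of_mem_image_bandMap U hε h hK).1
    have hO : (Qᶜ ∩ (range ⇑K)ᶜ) ∈ 𝓝 q :=
      (hQc.isOpen_compl.inter K.isClosed_range.isOpen_compl).mem_nhds ⟨hqQ, hK⟩
    rw [Filter.mem_map]
    filter_upwards [hO] with p hp
    rw [mem_preimage]
    by_cases hpb : p ∈ D.band U
    · rw [D.circleMapFn_of_mem U hpb]
      have h1 : |D.height U p| < 1 := D.abs_height_lt_one U hpb
      have h2 : 1 - ε < |D.height U p| := by
        by_contra h
        exact hp.1 (D.mem_image_bandMap_of_abs_le U hpb (not_lt.1 h))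
      exact hεW _ h2.le h1.le
    · rw [D.circleMapFn_of_not_mem U hpb]
      exact mem_of_mem_nhds hW

/-! ### The circle map of the knot complement -/

/-- **The circle-valued map of the knot complement** along the Seifert surface `F°`.
[cite: Rolfsen1976, §5.C] -/
def circleMap : C(K.complement, Circle) where
  toFun x := D.circleMapFn U x.1
  continuous_toFun := continuous_iff_continuousAt.2 fun x =>
    (D.continuousAt_circleMapFn U x.2).comp continuous_subtype_val.continuousAt

/-- The circle map as a function. [folklore] -/
theorem circleMap_apply (x : K.complement) : D.circleMap U x = D.circleMapFn U x.1 := rfl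

/-- `e^{-iπ} ≠ 1`. [folklore] -/
theorem exp_neg_pi_ne_exp_zero : Circle.exp (-π) ≠ Circle.exp 0 := fun h => by
  have := eq_of_exp_eq_of_mem_Ioo (b := -π - 1) h ⟨by linarith, by linarith [Real.pi_gt_three]⟩
    ⟨by linarith [Real.pi_gt_three], by linarith [Real.pi_gt_three]⟩
  linarith [Real.pi_pos]

/-- On the band, `π h ∈ (-π, π)`. [folklore] -/
theorem pi_mul_height_mem_Ioo {q : 𝕊 3} (hq : q ∈ D.band U) : π * D.height U q ∈ Ioo (-π) (-π + 2 * π) := by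
  have h := abs_lt.1 (D.abs_height_lt_one U hq)
  constructor <;> nlinarith [h.1, h.2, Real.pi_pos]

/-- **`{circleMap ≠ -1}` is the band.** [folklore] -/
theorem circleMap_ne_neg_one_iff (x : K.complement) :
    D.circleMap U x ≠ Circle.exp (-π) ↔ x.1 ∈ D.band U := by
  rw [circleMap_apply]
  constructor
  · intro h
    by_contra hb
    exact h (D.circleMapFn_of_not_mem U hb)
  · intro hb h
    rw [D.circleMapFn_of_mem U hb] at h
    obtain ⟨m, hm⟩ := Circle.exp_eq_exp.1 h
    have h1 := abs_lt.1 (D.abs_height_lt_one U hb)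
    have hπ : (0 : ℝ) < π := Real.pi_pos
    have hm2 : (m : ℝ) = (D.height U x.1 + 1) / 2 := by
      have : π * ((m : ℝ) * 2) = π * (D.height U x.1 + 1) := by linear_combination -hm
      have := mul_left_cancel₀ hπ.ne' this
      linarith
    have h3 : (0 : ℝ) < m := by rw [hm2]; linarith [h1.1]
    have h4 : (m : ℝ) < 1 := by rw [hm2]; linarith [h1.2]
    have h5 : (0 : ℤ) < m := by exact_mod_cast h3
    have h6 : m < 1 := by exact_mod_cast h4
    omega

/-- **`{circleMap = 1}` is the open Seifert surface `F°`.** [folklore] -/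
theorem circleMap_eq_one_iff (x : K.complement) : D.circleMap U x = Circle.exp 0 ↔ x.1 ∈ D.surf := by
  rw [circleMap_apply]
  constructor
  · intro h
    by_cases hb : x.1 ∈ D.band U
    · rw [D.circleMapFn_of_mem U hb] at h
      have h0 := eq_of_exp_eq_of_mem_Ioo (b := -π) h (D.pi_mul_height_mem_Ioo U hb)
        ⟨by linarith [Real.pi_pos], by linarith [Real.pi_pos]⟩
      have : D.height U x.1 = 0 := by
        rcases mul_eq_zero.1 h0 with h' | h'
        · exact absurd h' Real.pi_pos.ne'
        · exact h'
      exact D.mem_surf_of_height_eq_zero U hb this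
    · rw [D.circleMapFn_of_not_mem U hb] at h
      exact absurd h exp_neg_pi_ne_exp_zero
  · intro hs
    rw [D.circleMapFn_of_mem U (D.surf_subset_band U hs), D.height_eq_zero_of_mem_surf U hs, mul_zero]

/-- **On the band, the branch of the angle of the circle map in `(-π, π)` is `π h`.** [folklore] -/
theorem sheetLevel_circleMap {x : K.complement} (hx : x.1 ∈ D.band U) :
    sheetLevel (D.circleMap U) (-π) x = π * D.height U x.1 := by
  have hne : D.circleMap U x ≠ Circle.exp (-π) := (D.circleMap_ne_neg_one_iff U x).2 hx
  apply eq_of_exp_eq_of_mem_Ioo (b := -π) _ (sheetLevel_mem_Ioo (D.circleMap U) (-π) hne)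
    (D.pi_mul_height_mem_Ioo U hx)
  rw [exp_sheetLevel, circleMap_apply, D.circleMapFn_of_mem U hx]

/-! ### The band trivialised over the angle -/

/-- The level `{circleMap = 1}` of the complement is the open Seifert surface `F° ⊆ 𝕊³`. [folklore] -/
def levelHomeomorph : ↥{x : K.complement | D.circleMap U x = Circle.exp 0} ≃ₜ ↥D.surf where
  toFun x := ⟨x.1.1, (D.circleMap_eq_one_iff U x.1).1 x.2⟩
  invFun y := ⟨⟨y.1, D.surf_subset_compl_range y.2⟩, (D.circleMap_eq_one_iff U _).2 y.2⟩
  left_inv _ := rfl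
  right_inv _ := rfl
  continuous_toFun := (continuous_subtype_val.comp continuous_subtype_val).subtype_mk _
  continuous_invFun := (continuous_subtype_val.subtype_mk _).subtype_mk _

/-- The band `{circleMap ≠ -1}` of the complement is the band `N ⊆ 𝕊³`. [folklore] -/
def bandLevelHomeomorph : ↥(D.band U) ≃ₜ ↥{x : K.complement | D.circleMap U x ≠ Circle.exp (-π)} where
  toFun q := ⟨⟨q.1, D.band_subset_compl_range U q.2⟩, (D.circleMap_ne_neg_one_iff U _).2 q.2⟩
  invFun x := ⟨x.1.1, (D.circleMap_ne_neg_one_iff U x.1).1 x.2⟩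
  left_inv _ := rfl
  right_inv _ := rfl
  continuous_toFun := (continuous_subtype_val.subtype_mk _).subtype_mk _
  continuous_invFun := (continuous_subtype_val.comp continuous_subtype_val).subtype_mk _

/-- **The band of the Seifert surface, trivialised over the angle of the circle map**
(`Ψ (y, t) = fl y (t · w y)`, `sheetLevel (Ψ (y, t)) = π t`). [cite: Rolfsen1976, §5.C] -/
def circleBandData : CircleBandData (D.circleMap U) where
  Ψ := ((D.levelHomeomorph U).prodCongr (Homeomorph.refl _)).trans
    ((D.bandHomeomorph U).trans (D.bandLevelHomeomorph U))
  level_Ψ y t := by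
    have hy : (y : K.complement).1 ∈ D.surf := (D.circleMap_eq_one_iff U y.1).1 y.2
    have hmem : D.bandMap U (y : K.complement).1 t ∈ D.band U := D.bandMap_mem_band U hy (abs_lt.2 t.2)
    change sheetLevel (D.circleMap U) (-π)
      (⟨D.bandMap U (y : K.complement).1 t, D.band_subset_compl_range U hmem⟩ : K.complement) = π * t
    rw [D.sheetLevel_circleMap U hmem]
    change π * D.height U (D.bandMap U (y : K.complement).1 t) = π * t
    rw [D.height_bandMap U hy (abs_lt.2 t.2).le]

/-- The trivialisation as a map to `𝕊³`. [folklore] -/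
theorem circleBandData_Ψ_apply (y : ↥{x : K.complement | D.circleMap U x = Circle.exp 0}) (t : Ioo (-1 : ℝ) 1) :
    (((D.circleBandData U).Ψ (y, t) : K.complement) : 𝕊 3) = D.bandMap U (y : K.complement).1 t := rfl

/-- **The cut `{circleMap = 1} ≅ F°` is path connected.** [folklore] -/
theorem pathConnectedSpace_circleMap_level :
    PathConnectedSpace ↥{x : K.complement | D.circleMap U x = Circle.exp 0} := by
  haveI : PathConnectedSpace ↥D.surf := isPathConnected_iff_pathConnectedSpace.1 D.isPathConnected_surf
  exact (D.levelHomeomorph U).symm.surjective.pathConnectedSpace (D.levelHomeomorph U).symm.continuous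

end SeifertDatum

end Literature.Topology.FourManifolds
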